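import Literature.Analysis.TotalPositivity.PolyaFrequencyFunctionsProofs
import Literature.Analysis.TotalPositivity.PolyaFrequencyConvolution
import Literature.Analysis.TotalPositivity.PolyaFrequencyDecay
import Literature.Analysis.TotalPositivity.PolyaFrequencyGaussianStrict
import Mathlib.LinearAlgebra.Matrix.AbsoluteValue
import HarnessLib

/-!
# Gaussian smoothing makes a Pólya frequency function strictly totally positive
(Schoenberg 1951, necessity half, step N2b)

Trunk `Literature/Analysis/TotalPositivity`, tenth proofs file accompanying
`PolyaFrequencyFunctions.lean` (the named fact `schoenberg1951_pf_laplace`).  Karlin's smoothing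
device for the necessity half of Schoenberg's theorem: if `Λ` is a Pólya frequency function and
`φ(u) = e^{−au²}` (`a > 0`), then the doubly smoothed kernel `K = φ ⋆ (Λ ⋆ φ)` is a Pólya
frequency function all of whose translation determinants with increasing nodes are STRICTLY
positive (`IsPolyaFrequencyFun.translationMinor_smoothing_pos`).

Proof.  Two applications of the basic composition formula
(`factorial_mul_translationMinor_conv`) reduce the claim to the positivity, on a set of positive
measure, of `s ↦ det ‖Λ(s_i − r_j)‖` for suitable `r`; this is obtained WITHOUT any measure-theoretic
induction from the elementary structure of `Λ` (`PolyaFrequencyDecay.lean`): `Λ ≥ m > 0` on some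
interval `(p₀, q₀)`, `Λ ≤ M`, `Λ(x) ≤ C e^{−η|x|}`.  For widely spaced nodes `s_i ≈ iL`,
`r_j ≈ jL` with `s_i − r_i ∈ (p₀, q₀)` the matrix `‖Λ(s_i − r_j)‖` is diagonally dominant:
diagonal entries `≥ m`, off-diagonal ones `≤ C e^{−η(L − const)}`, so its determinant is
`≥ mⁿ − n! M^{n−1} C e^{−η(L−const)} > 0` for `L` large (`exists_boxes_translationMinor_pos`);
the strict total positivity of the Gaussian (`translationMinor_gaussian_pos`) does the rest.

## References

* S. Karlin, *Total Positivity* I (1968), Ch. 3 §1 and Ch. 7 §2 (smoothing by the Gauss kernel;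
  extended total positivity). [Karlin1968]
* I. J. Schoenberg, *On Pólya frequency functions. I*, J. Analyse Math. 1 (1951) 331–374, §6.
  [Schoenberg1951]
-/

noncomputable section

open MeasureTheory Set Filter Finset
open scoped Topology

namespace Literature.Analysis.TotalPositivity

/-! ### Measurability and integrability of the composition integrand -/

/-- `s ↦ det ‖f(x_i − s_j)‖` is measurable for measurable `f`. [folklore] -/
theorem measurable_translationMinor_right {f : ℝ → ℝ} (hf : Measurable f) {n : ℕ} (x : Fin n → ℝ) :
    Measurable fun S : Fin n → ℝ => translationMinor f x S := by
  classical
  unfold translationMinor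
  have h : (fun S : Fin n → ℝ => (Matrix.of fun i j : Fin n => f (x i - S j)).det) =
      fun S => ∑ σ : Equiv.Perm (Fin n), ((Equiv.Perm.sign σ : ℤ) : ℝ) * ∏ i, f (x (σ i) - S i) := by
    funext S
    rw [Matrix.det_apply']
    rfl
  rw [h]
  refine Finset.measurable_sum _ fun σ _ => Measurable.const_mul ?_ _
  exact Finset.measurable_prod _ fun i _ => hf.comp (measurable_const.sub (measurable_pi_apply i))

/-- `s ↦ det ‖g(s_i − y_j)‖` is measurable for measurable `g`. [folklore] -/
theorem measurable_translationMinor_left {g : ℝ → ℝ} (hg : Measurable g) {n : ℕ} (y : Fin n → ℝ) :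
    Measurable fun S : Fin n → ℝ => translationMinor g S y := by
  classical
  unfold translationMinor
  have h : (fun S : Fin n → ℝ => (Matrix.of fun i j : Fin n => g (S i - y j)).det) =
      fun S => ∑ σ : Equiv.Perm (Fin n), ((Equiv.Perm.sign σ : ℤ) : ℝ) * ∏ i, g (S (σ i) - y i) := by
    funext S
    rw [Matrix.det_apply']
    rfl
  rw [h]
  refine Finset.measurable_sum _ fun σ _ => Measurable.const_mul ?_ _
  exact Finset.measurable_prod _ fun i _ => hg.comp ((measurable_pi_apply (σ i)).sub measurable_const)

/-- A translation determinant of a function bounded by `B` is bounded by `n! Bⁿ`. [folklore] -/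
theorem abs_translationMinor_le {g : ℝ → ℝ} {B : ℝ} (hgB : ∀ u, |g u| ≤ B) {n : ℕ} (S y : Fin n → ℝ) :
    |translationMinor g S y| ≤ (Nat.factorial n : ℝ) * B ^ n := by
  unfold translationMinor
  have h := Matrix.det_le (abv := AbsoluteValue.abs) (A := Matrix.of fun i j : Fin n => g (S i - y j))
    (x := B) fun i j => by
      simp only [Matrix.of_apply, AbsoluteValue.abs_apply]
      exact hgB _
  simpa [Fintype.card_fin, nsmul_eq_mul] using h

/-- **Integrability of the composition integrand** `s ↦ det ‖f(x_i − s_j)‖ det ‖g(s_i − y_j)‖` for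
`f` integrable and `g` bounded (both measurable). [folklore] -/
theorem integrable_translationMinor_mul {f g : ℝ → ℝ} (hf : Integrable f) (hfm : Measurable f)
    (hgm : Measurable g) {B : ℝ} (hgB : ∀ u, |g u| ≤ B) {n : ℕ} (x y : Fin n → ℝ) :
    Integrable fun S : Fin n → ℝ => translationMinor f x S * translationMinor g S y := by
  classical
  set F : (Fin n → ℝ) → ℝ := fun S => ∑ σ : Equiv.Perm (Fin n), ∏ i, |f (x (σ i) - S i)| with hF
  have hFi : Integrable F := by
    refine integrable_finsetSum _ fun σ _ => ?_
    exact Integrable.fintype_prod (f := fun i s => |f (x (σ i) - s)|) fun i => (hf.comp_sub_left _).abs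
  have hmeas : Measurable fun S : Fin n → ℝ => translationMinor f x S * translationMinor g S y :=
    (measurable_translationMinor_right hfm x).mul (measurable_translationMinor_left hgm y)
  refine (hFi.mul_const ((Nat.factorial n : ℝ) * B ^ n)).mono' hmeas.aestronglyMeasurable
    (Eventually.of_forall fun S => ?_)
  rw [Real.norm_eq_abs, abs_mul]
  have h1 : |translationMinor f x S| ≤ F S := by
    unfold translationMinor
    rw [Matrix.det_apply', hF]
    refine (Finset.abs_sum_le_sum_abs _ _).trans (Finset.sum_le_sum fun σ _ => ?_)
    rw [abs_mul, Finset.abs_prod]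
    have hsign : |((Equiv.Perm.sign σ : ℤ) : ℝ)| = 1 := by
      rcases Int.units_eq_one_or (Equiv.Perm.sign σ) with h | h <;> simp [h]
    rw [hsign, one_mul]
    rfl
  have hF0 : 0 ≤ F S := hF ▸ Finset.sum_nonneg fun σ _ => Finset.prod_nonneg fun i _ => abs_nonneg _
  exact mul_le_mul h1 (abs_translationMinor_le hgB S y) (abs_nonneg _) hF0

/-! ### Diagonally dominant translation determinants of `Λ` -/

/-- **A Pólya frequency function is bounded below on an interval**: there are `p₀ < q₀` and
`m > 0` with `Λ ≥ m` on `(p₀, q₀)` (from `PF₂` and boundedness). [folklore] -/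
theorem IsPolyaFrequencyFun.exists_interval_ge {Λ : ℝ → ℝ} (h : IsPolyaFrequencyFun Λ) :
    ∃ p₀ q₀ m : ℝ, p₀ < q₀ ∧ 0 < m ∧ ∀ a ∈ Set.Ioo p₀ q₀, m ≤ Λ a := by
  obtain ⟨p, q, hpq, hp, hq⟩ := h.exists_two_pos
  obtain ⟨M, hM⟩ := h.exists_bound
  have hM0 : 0 < M := hp.trans_le (hM p)
  refine ⟨p, q, Λ p * Λ q / M, hpq, div_pos (mul_pos hp hq) hM0, fun a ha => ?_⟩
  rw [div_le_iff₀ hM0]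
  calc Λ p * Λ q ≤ Λ a * Λ (p + q - a) := h.pf2_ineq ha.1 ha.2
    _ ≤ Λ a * M := mul_le_mul_of_nonneg_left (hM _) (h.nonneg a)

/-- **Positive translation determinants of `Λ` on boxes.**  For a Pólya frequency function `Λ` and
every `n` there are open boxes `∏ (α_i, β_i)` and `∏ (α'_j, β'_j)` in `ℝⁿ`, consisting of strictly
increasing tuples, such that `det ‖Λ(s_i − r_j)‖ > 0` for all `s`, `r` in the boxes (widely spaced,
diagonally dominant configurations). [cite: Karlin1968, Ch. 7 §2] [folklore] -/
theorem IsPolyaFrequencyFun.exists_boxes_translationMinor_pos {Λ : ℝ → ℝ} (h : IsPolyaFrequencyFun Λ)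
    (n : ℕ) :
    ∃ (αS βS αR βR : Fin n → ℝ), (∀ i, αS i < βS i) ∧ (∀ j, αR j < βR j) ∧
      (∀ S : Fin n → ℝ, (∀ i, S i ∈ Set.Ioo (αS i) (βS i)) → StrictMono S) ∧
      (∀ R : Fin n → ℝ, (∀ j, R j ∈ Set.Ioo (αR j) (βR j)) → StrictMono R) ∧
      ∀ S R : Fin n → ℝ, (∀ i, S i ∈ Set.Ioo (αS i) (βS i)) → (∀ j, R j ∈ Set.Ioo (αR j) (βR j)) →
        0 < translationMinor Λ S R := by
  classical
  obtain ⟨p₀, q₀, m, hpq, hm, hlow⟩ := h.exists_interval_ge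
  obtain ⟨M, hM⟩ := h.exists_bound
  have hM0 : 0 < M := by
    have := hlow ((p₀ + q₀) / 2) ⟨by linarith, by linarith⟩
    exact hm.trans_le (this.trans (hM _))
  have hmM : m ≤ M := (hlow ((p₀ + q₀) / 2) ⟨by linarith, by linarith⟩).trans (hM _)
  obtain ⟨η, hη, C, hC0, hdecay⟩ := h.exists_exp_decay
  set w := (q₀ - p₀) / 4 with hw
  have hw0 : 0 < w := by rw [hw]; linarith
  set p₁ := p₀ + w with hp₁
  set q₁ := q₀ - w with hq₁
  set ρ' := w / 2 with hρ'
  have hρ'0 : 0 < ρ' := by rw [hρ']; linarith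
  set A₁ := max |p₁| |q₁| with hA₁
  -- choice of the spacing `L`
  have hδ : Tendsto (fun L : ℝ => C * Real.exp (-(η * (L - A₁ - ρ')))) atTop (𝓝 0) := by
    have h1 : Tendsto (fun L : ℝ => -(η * (L - A₁ - ρ'))) atTop atBot := by
      have : Tendsto (fun L : ℝ => η * (L - A₁ - ρ')) atTop atTop :=
        (tendsto_id.atTop_add (tendsto_const_nhds (x := -A₁ - ρ'))).const_mul_atTop hη |>.congr
          fun L => by simp only [id_eq]; ring
      exact tendsto_neg_atTop_atBot.comp this
    simpa using (Real.tendsto_exp_atBot.comp h1).const_mul C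
  have htarget : 0 < m ^ n / (2 * ((Nat.factorial n : ℝ) * M ^ n / m + 1)) := by positivity
  obtain ⟨L, hL⟩ := ((hδ.eventually (gt_mem_nhds htarget)).and
    ((eventually_ge_atTop (q₁ - p₁)).and ((eventually_ge_atTop (2 * ρ')).and
      (eventually_ge_atTop (A₁ + ρ'))))).exists
  obtain ⟨hLδ, hL1, hL2, hL3⟩ := hL
  set δ := C * Real.exp (-(η * (L - A₁ - ρ'))) with hδdef
  have hδ0 : 0 ≤ δ := mul_nonneg hC0 (Real.exp_pos _).le
  -- the boxes
  refine ⟨fun i => (i : ℕ) * L + p₁, fun i => (i : ℕ) * L + q₁, fun j => (j : ℕ) * L - ρ',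
    fun j => (j : ℕ) * L + ρ', fun i => by simp only; linarith [show p₁ < q₁ by rw [hp₁, hq₁]; linarith],
    fun j => by simp only; linarith, ?_, ?_, ?_⟩
  · -- `S` strictly increasing
    intro S hS i j hij
    have hi := (hS i).2
    have hj := (hS j).1
    have hij' : ((i : ℕ) : ℝ) + 1 ≤ ((j : ℕ) : ℝ) := by
      have : (i : ℕ) + 1 ≤ (j : ℕ) := hij
      exact_mod_cast this
    have hL0 : 0 ≤ L := le_trans (by linarith) hL2
    nlinarith
  · -- `R` strictly increasing
    intro R hR i j hij
    have hi := (hR i).2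
    have hj := (hR j).1
    have hij' : ((i : ℕ) : ℝ) + 1 ≤ ((j : ℕ) : ℝ) := by
      have : (i : ℕ) + 1 ≤ (j : ℕ) := hij
      exact_mod_cast this
    have hL0 : 0 ≤ L := le_trans (by linarith) hL2
    nlinarith
  · -- positivity of the determinant
    intro S R hS hR
    -- diagonal entries
    have hdiag : ∀ i, m ≤ Λ (S i - R i) := fun i => by
      refine hlow _ ⟨?_, ?_⟩
      · have := (hS i).1
        have := (hR i).2
        rw [hp₁] at *
        rw [hρ'] at *
        linarith
      · have := (hS i).2
        have := (hR i).1
        rw [hq₁] at *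
        rw [hρ'] at *
        linarith
    -- off-diagonal entries
    have hoff : ∀ i j, i ≠ j → Λ (S i - R j) ≤ δ := by
      intro i j hij
      refine (hdecay _).trans ?_
      rw [hδdef]
      refine mul_le_mul_of_nonneg_left (Real.exp_le_exp.2 ?_) hC0
      -- `η (L - A₁ - ρ') ≤ η |S i - R j|`
      have hSi1 := (hS i).1
      have hSi2 := (hS i).2
      have hRj1 := (hR j).1
      have hRj2 := (hR j).2
      have hs : |S i - (i : ℕ) * L| ≤ A₁ := by
        rw [abs_le]
        constructor
        · have : -A₁ ≤ p₁ := by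
            have := neg_abs_le p₁
            have := le_max_left |p₁| |q₁|
            linarith
          linarith
        · have : q₁ ≤ A₁ := (le_abs_self q₁).trans (le_max_right _ _)
          linarith
      have hr : |R j - (j : ℕ) * L| ≤ ρ' := by
        rw [abs_le]
        constructor <;> linarith
      have hij1 : 1 ≤ |((i : ℕ) : ℝ) - ((j : ℕ) : ℝ)| := by
        have hne : (i : ℕ) ≠ (j : ℕ) := fun h' => hij (Fin.ext h')
        rcases lt_or_gt_of_ne hne with hlt | hlt
        · have : ((i : ℕ) : ℝ) + 1 ≤ ((j : ℕ) : ℝ) := by exact_mod_cast hlt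
          rw [abs_sub_comm, abs_of_pos (by linarith)]
          linarith
        · have : ((j : ℕ) : ℝ) + 1 ≤ ((i : ℕ) : ℝ) := by exact_mod_cast hlt
          rw [abs_of_pos (by linarith)]
          linarith
      have hL0 : 0 ≤ L := le_trans (by linarith) hL2
      have hkey : L - A₁ - ρ' ≤ |S i - R j| := by
        set D : ℝ := (((i : ℕ) : ℝ) - ((j : ℕ) : ℝ)) * L with hD
        set e : ℝ := (S i - (i : ℕ) * L) - (R j - (j : ℕ) * L) with he
        have hdecomp : S i - R j = D + e := by
          rw [hD, he]
          ring
        rw [hdecomp]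
        have h2 : L ≤ |D| := by
          rw [hD, abs_mul, abs_of_nonneg hL0]
          nlinarith
        have h3 : |e| ≤ A₁ + ρ' := by
          rw [he]
          exact (abs_sub _ _).trans (add_le_add hs hr)
        have h4 : |D| ≤ |D + e| + |e| := by
          have := abs_sub (D + e) e
          rwa [add_sub_cancel_right] at this
        linarith
      nlinarith
    -- expand the determinant and separate the identity permutation
    unfold translationMinor
    rw [Matrix.det_apply', ← Finset.add_sum_erase _ _ (Finset.mem_univ (1 : Equiv.Perm (Fin n)))]
    simp only [Equiv.Perm.sign_one, Units.val_one, Int.cast_one, one_mul, Equiv.Perm.coe_one, id_eq,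
      Matrix.of_apply]
    -- the diagonal term
    have hmain : m ^ n ≤ ∏ i, Λ (S i - R i) := by
      calc m ^ n = ∏ _i : Fin n, m := by simp
        _ ≤ ∏ i, Λ (S i - R i) := Finset.prod_le_prod (fun i _ => hm.le) fun i _ => hdiag i
    -- the other terms
    have hrest : ∀ σ ∈ (Finset.univ : Finset (Equiv.Perm (Fin n))).erase 1,
        |((Equiv.Perm.sign σ : ℤ) : ℝ) * ∏ i, Λ (S (σ i) - R i)| ≤ δ * M ^ n / m := by
      intro σ hσ
      have hσ1 : σ ≠ 1 := Finset.ne_of_mem_erase hσ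
      obtain ⟨i₀, hi₀⟩ : ∃ i₀, σ i₀ ≠ i₀ := by
        by_contra hall
        push Not at hall
        exact hσ1 (Equiv.ext hall)
      rw [abs_mul]
      have hsign : |((Equiv.Perm.sign σ : ℤ) : ℝ)| = 1 := by
        rcases Int.units_eq_one_or (Equiv.Perm.sign σ) with h' | h' <;> simp [h']
      rw [hsign, one_mul, Finset.abs_prod, ← Finset.mul_prod_erase _ _ (Finset.mem_univ i₀)]
      have h1 : |Λ (S (σ i₀) - R i₀)| ≤ δ := by
        rw [abs_of_nonneg (h.nonneg _)]
        exact hoff _ _ hi₀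
      have h2 : ∏ i ∈ (Finset.univ : Finset (Fin n)).erase i₀, |Λ (S (σ i) - R i)| ≤ M ^ (n - 1) := by
        calc ∏ i ∈ (Finset.univ : Finset (Fin n)).erase i₀, |Λ (S (σ i) - R i)|
            ≤ ∏ _i ∈ (Finset.univ : Finset (Fin n)).erase i₀, M :=
              Finset.prod_le_prod (fun i _ => abs_nonneg _) fun i _ => by
                rw [abs_of_nonneg (h.nonneg _)]
                exact hM _
          _ = M ^ (n - 1) := by
              rw [Finset.prod_const, Finset.card_erase_of_mem (Finset.mem_univ _), Finset.card_univ,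
                Fintype.card_fin]
      have h3 : M ^ (n - 1) ≤ M ^ n / m := by
        rw [le_div_iff₀ hm]
        have hn : 1 ≤ n := Nat.one_le_iff_ne_zero.2 (by
          rintro rfl
          exact Fin.elim0 i₀)
        calc M ^ (n - 1) * m ≤ M ^ (n - 1) * M := mul_le_mul_of_nonneg_left hmM (pow_nonneg hM0.le _)
          _ = M ^ n := by rw [← pow_succ, Nat.sub_add_cancel hn]
      calc |Λ (S (σ i₀) - R i₀)| * ∏ i ∈ (Finset.univ : Finset (Fin n)).erase i₀, |Λ (S (σ i) - R i)|
          ≤ δ * M ^ (n - 1) :=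
            mul_le_mul h1 h2 (Finset.prod_nonneg fun i _ => abs_nonneg _) hδ0
        _ ≤ δ * (M ^ n / m) := mul_le_mul_of_nonneg_left h3 hδ0
        _ = δ * M ^ n / m := by ring
    have hsum : |∑ σ ∈ (Finset.univ : Finset (Equiv.Perm (Fin n))).erase 1,
        ((Equiv.Perm.sign σ : ℤ) : ℝ) * ∏ i, Λ (S (σ i) - R i)| ≤
        (Nat.factorial n : ℝ) * (δ * M ^ n / m) := by
      refine (Finset.abs_sum_le_sum_abs _ _).trans ?_
      refine (Finset.sum_le_sum hrest).trans ?_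
      rw [Finset.sum_const, nsmul_eq_mul]
      refine mul_le_mul_of_nonneg_right ?_ (by positivity)
      have : ((Finset.univ : Finset (Equiv.Perm (Fin n))).erase 1).card ≤ Nat.factorial n := by
        rw [Finset.card_erase_of_mem (Finset.mem_univ _), Finset.card_univ, Fintype.card_perm,
          Fintype.card_fin]
        exact Nat.sub_le _ _
      exact_mod_cast this
    have hsmall : (Nat.factorial n : ℝ) * (δ * M ^ n / m) < m ^ n := by
      have h1 : δ < m ^ n / (2 * ((Nat.factorial n : ℝ) * M ^ n / m + 1)) := hLδ
      have h2 : 0 < (Nat.factorial n : ℝ) * M ^ n / m + 1 := by positivity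
      calc (Nat.factorial n : ℝ) * (δ * M ^ n / m) = δ * ((Nat.factorial n : ℝ) * M ^ n / m) := by ring
        _ ≤ δ * ((Nat.factorial n : ℝ) * M ^ n / m + 1) :=
            mul_le_mul_of_nonneg_left (by linarith) hδ0
        _ < m ^ n / (2 * ((Nat.factorial n : ℝ) * M ^ n / m + 1)) *
            ((Nat.factorial n : ℝ) * M ^ n / m + 1) := mul_lt_mul_of_pos_right h1 h2
        _ = m ^ n / 2 := by field_simp
        _ < m ^ n := by linarith [pow_pos hm n]
    have habs := neg_abs_le (∑ σ ∈ (Finset.univ : Finset (Equiv.Perm (Fin n))).erase 1,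
        ((Equiv.Perm.sign σ : ℤ) : ℝ) * ∏ i, Λ (S (σ i) - R i))
    linarith

/-! ### Strict total positivity of the smoothed kernel -/

/-- **Karlin's smoothing device.**  For a Pólya frequency function `Λ` and `a > 0`, the kernel
`K = φ_a ⋆ (Λ ⋆ φ_a)`, `φ_a(u) = e^{−au²}`, i.e. `K(u) = ∫ φ_a(t) H(u − t) dt` with
`H(v) = ∫ Λ(r) φ_a(v − r) dr`, has STRICTLY positive translation determinants:
`det ‖K(x_i − y_j)‖ > 0` for all strictly increasing `x, y : Fin n → ℝ`.
[cite: Karlin1968, Ch. 7 §2] [cite: Schoenberg1951, §6] -/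
theorem IsPolyaFrequencyFun.translationMinor_smoothing_pos {Λ : ℝ → ℝ} (h : IsPolyaFrequencyFun Λ)
    {a : ℝ} (ha : 0 < a) {n : ℕ} {x y : Fin n → ℝ} (hx : StrictMono x) (hy : StrictMono y) :
    0 < translationMinor (fun u => ∫ t, Real.exp (-a * t ^ 2) *
      (fun v => ∫ r, Λ r * Real.exp (-a * (v - r) ^ 2)) (u - t)) x y := by
  classical
  set φ : ℝ → ℝ := fun u => Real.exp (-a * u ^ 2) with hφdef
  have hφpf : IsPolyaFrequencyFun φ := by
    simpa [hφdef] using isPolyaFrequencyFun_gaussian ha one_pos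
  have hφle : ∀ u, φ u ≤ 1 := fun u => Real.exp_le_one_iff.2 (by nlinarith [sq_nonneg u])
  have hφabs : ∀ u, |φ u| ≤ 1 := fun u => by
    rw [abs_of_nonneg (Real.exp_pos _).le]
    exact hφle u
  set H : ℝ → ℝ := fun v => ∫ r, Λ r * φ (v - r) with hHdef
  have hHpf : IsPolyaFrequencyFun H := h.conv hφpf hφle
  set B : ℝ := 1 * ∫ r, Λ r with hBdef
  have hHle : ∀ v, H v ≤ B := fun v => conv_le_of_le h hφpf.nonneg hφle v
  have hHabs : ∀ v, |H v| ≤ B := fun v => by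
    rw [abs_of_nonneg (hHpf.nonneg v)]
    exact hHle v
  -- the goal is the kernel `K = φ ⋆ H`
  show 0 < translationMinor (fun u => ∫ t, φ t * H (u - t)) x y
  -- second composition
  have hcomp2 := factorial_mul_translationMinor_conv φ H hφpf.integrable hHpf.measurable hHabs x y
  set Φ₂ : (Fin n → ℝ) → ℝ := fun S => translationMinor φ x S * translationMinor H S y with hΦ₂
  have hΦ₂0 : ∀ S, 0 ≤ Φ₂ S := fun S => translationMinor_mul_nonneg hφpf hHpf hx hy S
  have hΦ₂i : Integrable Φ₂ :=
    integrable_translationMinor_mul hφpf.integrable hφpf.measurable hHpf.measurable hHabs x y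
  -- the boxes
  obtain ⟨αS, βS, αR, βR, hαβS, hαβR, hSmono, hRmono, hpos⟩ := h.exists_boxes_translationMinor_pos n
  -- on the `S`-box the second factor is positive
  have hHpos : ∀ S : Fin n → ℝ, (∀ i, S i ∈ Set.Ioo (αS i) (βS i)) →
      0 < translationMinor H S y := by
    intro S hS
    have hS' := hSmono S hS
    have hcomp1 := factorial_mul_translationMinor_conv Λ φ h.integrable hφpf.measurable hφabs S y
    set Φ₁ : (Fin n → ℝ) → ℝ := fun R => translationMinor Λ S R * translationMinor φ R y with hΦ₁
    have hΦ₁0 : ∀ R, 0 ≤ Φ₁ R := fun R => translationMinor_mul_nonneg h hφpf hS' hy R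
    have hΦ₁i : Integrable Φ₁ :=
      integrable_translationMinor_mul h.integrable h.measurable hφpf.measurable hφabs S y
    have hint : 0 < ∫ R, Φ₁ R := by
      rw [integral_pos_iff_support_of_nonneg hΦ₁0 hΦ₁i]
      have hopen : IsOpen (Set.pi Set.univ fun j : Fin n => Set.Ioo (αR j) (βR j)) :=
        isOpen_set_pi Set.finite_univ fun j _ => isOpen_Ioo
      have hne : (Set.pi Set.univ fun j : Fin n => Set.Ioo (αR j) (βR j)).Nonempty :=
        Set.univ_pi_nonempty_iff.2 fun j => nonempty_Ioo.2 (hαβR j)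
      have hsub : (Set.pi Set.univ fun j : Fin n => Set.Ioo (αR j) (βR j)) ⊆ Function.support Φ₁ := by
        intro R hR
        have hR' : ∀ j, R j ∈ Set.Ioo (αR j) (βR j) := fun j => hR j (Set.mem_univ j)
        exact ne_of_gt (mul_pos (hpos S R hS hR') (translationMinor_gaussian_pos ha (hRmono R hR') hy))
      exact (hopen.measure_pos volume hne).trans_le (measure_mono hsub)
    have hn : (0 : ℝ) < Nat.factorial n := by positivity
    rw [← hcomp1] at hint
    exact (mul_pos_iff_of_pos_left hn).1 hint
  -- hence the second composition integrand is positive on the `S`-box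
  have hint2 : 0 < ∫ S, Φ₂ S := by
    rw [integral_pos_iff_support_of_nonneg hΦ₂0 hΦ₂i]
    have hopen : IsOpen (Set.pi Set.univ fun i : Fin n => Set.Ioo (αS i) (βS i)) :=
      isOpen_set_pi Set.finite_univ fun i _ => isOpen_Ioo
    have hne : (Set.pi Set.univ fun i : Fin n => Set.Ioo (αS i) (βS i)).Nonempty :=
      Set.univ_pi_nonempty_iff.2 fun i => nonempty_Ioo.2 (hαβS i)
    have hsub : (Set.pi Set.univ fun i : Fin n => Set.Ioo (αS i) (βS i)) ⊆ Function.support Φ₂ := by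
      intro S hS
      have hS' : ∀ i, S i ∈ Set.Ioo (αS i) (βS i) := fun i => hS i (Set.mem_univ i)
      exact ne_of_gt (mul_pos (translationMinor_gaussian_pos ha hx (hSmono S hS')) (hHpos S hS'))
    exact (hopen.measure_pos volume hne).trans_le (measure_mono hsub)
  have hn : (0 : ℝ) < Nat.factorial n := by positivity
  rw [← hcomp2] at hint2
  exact (mul_pos_iff_of_pos_left hn).1 hint2

/-- The smoothed kernel is itself a Pólya frequency function (two convolutions).
[cite: Schoenberg1951, Lemma 1] -/
theorem IsPolyaFrequencyFun.smoothing {Λ : ℝ → ℝ} (h : IsPolyaFrequencyFun Λ) {a : ℝ} (ha : 0 < a) :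
    IsPolyaFrequencyFun fun u => ∫ t, Real.exp (-a * t ^ 2) *
      (fun v => ∫ r, Λ r * Real.exp (-a * (v - r) ^ 2)) (u - t) := by
  have hφpf : IsPolyaFrequencyFun fun u => Real.exp (-a * u ^ 2) := by
    simpa using isPolyaFrequencyFun_gaussian ha one_pos
  have hφle : ∀ u, Real.exp (-a * u ^ 2) ≤ 1 := fun u =>
    Real.exp_le_one_iff.2 (by nlinarith [sq_nonneg u])
  have hHpf : IsPolyaFrequencyFun fun v => ∫ r, Λ r * Real.exp (-a * (v - r) ^ 2) := h.conv hφpf hφle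
  exact hφpf.conv hHpf (fun v => conv_le_of_le h hφpf.nonneg hφle v)

end Literature.Analysis.TotalPositivity

end
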